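import Mathlib.AlgebraicTopology.FundamentalGroupoid.Basic
import HarnessLib

/-!
# Loop erasure: a closed walk is null-homotopic when its vertex-simple closed sub-walks are

Topic: Topology (combinatorics of walks of paths; used in Topology / PlanarFoliations for the
closed walks traced by leaves along a separatrix graph). Let `pos : V → Y` place abstract
vertices in a topological space and let a **walk** be a finite composable sequence of paths
of `Y` between placed vertices (`Walk pos a b`, an inductive type, so that composites need no
casts). We prove the **loop erasure principle**: if every *vertex-simple* closed walk built
from the darts (the constituent paths, with their abstract end vertices) of a closed walk `w`
has null-homotopic composite, then the composite of `w` is null-homotopic. The proof is the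
usual erasure of closed sub-walks: at a repeated vertex `w = α γ δ` with `γ` closed and
shorter, `[w] = [α][γ][δ]`, and both `γ` and `α δ` are shorter closed walks over the same darts
(strong induction on the length). No planarity and no graph structure are involved; in the
application the vertex-simple closed walks over the separatrices of a planar separatrix graph
are simple polygons (Jordan curves) or backtracks.

* `Walk`, `Walk.comp`, `Walk.append`, `Walk.length`, `Walk.srcList`, `Walk.Darts`
  (**definitions**);
* `Walk.comp_append` (**proved**): the composite of a concatenation is the concatenation of the
  composites, up to homotopy;
* `Walk.exists_split` (**proved**): splitting a walk along a splitting of its source list;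
* `Walk.comp_homotopic_erase` (**proved**): erasing a null-homotopic closed sub-walk does not
  change the homotopy class of the composite (also the "telescoping" used for boundary walks
  with null excursions);
* `Walk.comp_homotopic_refl_of_forall_nodup` (**proved**, loop erasure).

All statements are [folklore] (e.g. the reduction of closed walks to cycles in the cycle space /
fundamental group of a graph).
-/

noncomputable section

open Set Function

namespace Literature.Topology.PlanarFoliations

universe u v

variable {V : Type u} {Y : Type v} [TopologicalSpace Y] {pos : V → Y}

/-- **Walks**: composable finite sequences of paths of `Y` between the placed vertices
`pos a`, `a : V`, with abstract end vertices. [folklore] -/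
inductive Walk (pos : V → Y) : V → V → Type (max u v)
  /-- the empty walk at `a` -/
  | nil (a : V) : Walk pos a a
  /-- prepend a path from `pos a` to `pos b` -/
  | cons {a b c : V} (p : Path (pos a) (pos b)) (w : Walk pos b c) : Walk pos a c

/-- A list containing `[v, v]` as a sublist splits around two occurrences of `v`. [folklore] -/
theorem exists_decomp_of_sublist {α : Type*} {v : α} : ∀ {l : List α}, [v, v].Sublist l →
    ∃ l₁ l₂ l₃, l = l₁ ++ v :: (l₂ ++ v :: l₃)
  | [], h => by simp at h
  | x :: l, h => by
    cases h with
    | cons _ h =>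
      obtain ⟨l₁, l₂, l₃, rfl⟩ := exists_decomp_of_sublist h
      exact ⟨x :: l₁, l₂, l₃, rfl⟩
    | cons_cons _ h =>
      obtain ⟨l₂, l₃, rfl⟩ := List.append_of_mem (List.singleton_sublist.1 h)
      exact ⟨[], l₂, l₃, rfl⟩

namespace Walk

variable {a b c d : V}

/-- The composite path of a walk. [folklore] -/
def comp : ∀ {a b : V}, Walk pos a b → Path (pos a) (pos b)
  | _, _, nil a => Path.refl (pos a)
  | _, _, cons p w => p.trans w.comp

/-- Concatenation of walks. [folklore] -/
def append : ∀ {a b c : V}, Walk pos a b → Walk pos b c → Walk pos a c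
  | _, _, _, nil _, w' => w'
  | _, _, _, cons p w, w' => cons p (w.append w')

/-- The length of a walk. [folklore] -/
def length : ∀ {a b : V}, Walk pos a b → ℕ
  | _, _, nil _ => 0
  | _, _, cons _ w => w.length + 1

/-- The list of source vertices of the darts of a walk. [folklore] -/
def srcList : ∀ {a b : V}, Walk pos a b → List V
  | _, _, nil _ => []
  | a, _, cons _ w => a :: w.srcList

/-- The set of darts of a walk: its paths with their abstract end vertices. [folklore] -/
def Darts : ∀ {a b : V}, Walk pos a b → Set (Σ a b : V, Path (pos a) (pos b))
  | _, _, nil _ => ∅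
  | a, _, @cons _ _ _ _ _ b _ p w => insert ⟨a, b, p⟩ w.Darts

/-- Composite of the empty walk. [folklore] -/
@[simp] theorem comp_nil (a : V) : (nil a : Walk pos a a).comp = Path.refl (pos a) := rfl

/-- Composite of a `cons`. [folklore] -/
@[simp] theorem comp_cons (p : Path (pos a) (pos b)) (w : Walk pos b c) : (cons p w).comp = p.trans w.comp := rfl

/-- Concatenation with the empty walk. [folklore] -/
@[simp] theorem nil_append (w : Walk pos a b) : (nil a).append w = w := rfl

/-- Concatenation of a `cons`. [folklore] -/
@[simp] theorem cons_append (p : Path (pos a) (pos b)) (w : Walk pos b c) (w' : Walk pos c d) :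
    (cons p w).append w' = cons p (w.append w') := rfl

/-- Length of the empty walk. [folklore] -/
@[simp] theorem length_nil (a : V) : (nil a : Walk pos a a).length = 0 := rfl

/-- Length of a `cons`. [folklore] -/
@[simp] theorem length_cons (p : Path (pos a) (pos b)) (w : Walk pos b c) : (cons p w).length = w.length + 1 := rfl

/-- Sources of the empty walk. [folklore] -/
@[simp] theorem srcList_nil (a : V) : (nil a : Walk pos a a).srcList = [] := rfl

/-- Sources of a `cons`. [folklore] -/
@[simp] theorem srcList_cons (p : Path (pos a) (pos b)) (w : Walk pos b c) : (cons p w).srcList = a :: w.srcList := rfl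

/-- Darts of the empty walk. [folklore] -/
@[simp] theorem darts_nil (a : V) : (nil a : Walk pos a a).Darts = ∅ := rfl

/-- Darts of a `cons`. [folklore] -/
@[simp] theorem darts_cons (p : Path (pos a) (pos b)) (w : Walk pos b c) :
    (cons p w).Darts = insert (⟨a, b, p⟩ : Σ a b : V, Path (pos a) (pos b)) w.Darts := rfl

/-- The source list has the length of the walk. [folklore] -/
@[simp] theorem length_srcList : ∀ {a b : V} (w : Walk pos a b), w.srcList.length = w.length
  | _, _, nil _ => rfl
  | _, _, cons _ w => by simp [length_srcList w]

/-- Length of a concatenation. [folklore] -/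
@[simp] theorem length_append : ∀ {a b c : V} (w : Walk pos a b) (w' : Walk pos b c),
    (w.append w').length = w.length + w'.length
  | _, _, _, nil _, w' => by simp
  | _, _, _, cons _ w, w' => by simp [length_append w w']; omega

/-- Source list of a concatenation. [folklore] -/
@[simp] theorem srcList_append : ∀ {a b c : V} (w : Walk pos a b) (w' : Walk pos b c),
    (w.append w').srcList = w.srcList ++ w'.srcList
  | _, _, _, nil _, w' => by simp
  | _, _, _, cons _ w, w' => by simp [srcList_append w w']

/-- Darts of a concatenation. [folklore] -/
@[simp] theorem darts_append : ∀ {a b c : V} (w : Walk pos a b) (w' : Walk pos b c),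
    (w.append w').Darts = w.Darts ∪ w'.Darts
  | _, _, _, nil _, w' => by simp
  | _, _, _, cons _ w, w' => by simp [darts_append w w', insert_union]

/-- **The first source of a nonempty walk is its start.** [folklore] -/
theorem head_srcList : ∀ {a b : V} (w : Walk pos a b) {v : V} {l : List V}, w.srcList = v :: l → a = v
  | _, _, nil _, _, _, h => by simp at h
  | _, _, cons _ _, _, _, h => by simp only [srcList_cons, List.cons.injEq] at h; exact h.1

/-- **The composite of a concatenation is the concatenation of the composites**, up to
homotopy. [folklore] -/
theorem comp_append : ∀ {a b c : V} (w : Walk pos a b) (w' : Walk pos b c),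
    (w.append w').comp.Homotopic (w.comp.trans w'.comp)
  | _, _, _, nil _, w' => by
    simp only [nil_append, comp_nil]
    exact ⟨(Path.Homotopy.reflTrans _).symm⟩
  | _, _, _, cons p w, w' => by
    simp only [cons_append, comp_cons]
    have h := comp_append w w'
    exact (Path.Homotopic.hcomp (Path.Homotopic.refl p) h).trans ⟨(Path.Homotopy.transAssoc _ _ _).symm⟩

/-- **Splitting a walk along a splitting of its source list.** [folklore] -/
theorem exists_split : ∀ {a c : V} (w : Walk pos a c) (l₁ l₂ : List V), w.srcList = l₁ ++ l₂ →
    ∃ (b : V) (w₁ : Walk pos a b) (w₂ : Walk pos b c), w = w₁.append w₂ ∧ w₁.srcList = l₁ ∧ w₂.srcList = l₂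
  | a, _, nil _, l₁, l₂, h => by
    simp only [srcList_nil, List.nil_eq, List.append_eq_nil_iff] at h
    obtain ⟨rfl, rfl⟩ := h
    exact ⟨a, nil a, nil a, rfl, rfl, rfl⟩
  | a, c, cons p w, [], l₂, h => ⟨a, nil a, cons p w, rfl, rfl, by simpa using h⟩
  | a, c, cons p w, v :: l₁, l₂, h => by
    simp only [srcList_cons, List.cons_append, List.cons.injEq] at h
    obtain ⟨rfl, h⟩ := h
    obtain ⟨b, w₁, w₂, rfl, h₁, h₂⟩ := exists_split w l₁ l₂ h
    exact ⟨b, cons p w₁, w₂, rfl, by simp [h₁], h₂⟩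

/-- **Erasing a null-homotopic closed sub-walk does not change the class of the composite.**
[folklore] -/
theorem comp_homotopic_erase (α : Walk pos a b) (γ : Walk pos b b) (δ : Walk pos b c)
    (hγ : γ.comp.Homotopic (Path.refl _)) :
    (α.append (γ.append δ)).comp.Homotopic (α.append δ).comp := by
  have h₁ := comp_append α (γ.append δ)
  have h₂ : (α.comp.trans (γ.append δ).comp).Homotopic (α.comp.trans (γ.comp.trans δ.comp)) :=
    Path.Homotopic.hcomp (Path.Homotopic.refl _) (comp_append γ δ)
  have h₃ : (α.comp.trans (γ.comp.trans δ.comp)).Homotopic (α.comp.trans ((Path.refl _).trans δ.comp)) :=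
    Path.Homotopic.hcomp (Path.Homotopic.refl _) (Path.Homotopic.hcomp hγ (Path.Homotopic.refl _))
  have h₄ : (α.comp.trans ((Path.refl _).trans δ.comp)).Homotopic (α.comp.trans δ.comp) :=
    Path.Homotopic.hcomp (Path.Homotopic.refl _) ⟨Path.Homotopy.reflTrans _⟩
  have h₅ : (α.comp.trans δ.comp).Homotopic (α.append δ).comp := (comp_append α δ).symm
  exact (((h₁.trans h₂).trans h₃).trans h₄).trans h₅

/-- **Loop erasure.** If every vertex-simple nonempty closed walk over the darts of the closed
walk `w` has null-homotopic composite, then the composite of `w` is null-homotopic.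
[folklore] -/
theorem comp_homotopic_refl_of_forall_nodup {a : V} (w : Walk pos a a)
    (H : ∀ (b : V) (γ : Walk pos b b), 0 < γ.length → γ.Darts ⊆ w.Darts → γ.srcList.Nodup →
      γ.comp.Homotopic (Path.refl _)) :
    w.comp.Homotopic (Path.refl _) := by
  -- strong induction on the length, over all closed walks with darts among those of `w`
  suffices key : ∀ (n : ℕ) (b : V) (γ : Walk pos b b), γ.length ≤ n → γ.Darts ⊆ w.Darts →
      γ.comp.Homotopic (Path.refl _) from key w.length a w le_rfl subset_rfl
  intro n
  induction n with
  | zero =>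
    intro b γ hlen _
    match γ, hlen with
    | nil _, _ => exact Path.Homotopic.refl _
    | cons _ _, hlen => simp at hlen
  | succ n ih =>
    intro b γ hlen hD
    by_cases hnd : γ.srcList.Nodup
    · -- vertex-simple: the hypothesis (or the empty walk)
      match γ, hlen, hD, hnd with
      | nil _, _, _, _ => exact Path.Homotopic.refl _
      | cons p γ', _, hD, hnd => exact H _ _ (by simp) hD hnd
    · -- a repeated source vertex: split `γ = α γ₀ δ` with `γ₀` closed at the repeated vertex
      obtain ⟨v, hv⟩ : ∃ v, [v, v].Sublist γ.srcList := by
        by_contra h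
        push Not at h
        exact hnd (List.nodup_iff_sublist.2 h)
      obtain ⟨l₁, l₂, l₃, hl⟩ := exists_decomp_of_sublist hv
      obtain ⟨b', α, rest, rfl, hα, hrest⟩ := exists_split γ l₁ _ hl
      have hb' : b' = v := head_srcList rest hrest
      subst hb'
      obtain ⟨b'', γ₀, δ, rfl, hγ₀, hδ⟩ := exists_split rest (b' :: l₂) (b' :: l₃) (by simpa using hrest)
      have hb'' : b'' = b' := head_srcList δ hδ
      subst hb''
      -- lengths
      have hlenγ₀ : γ₀.length ≤ n := by
        have h₁ := congrArg List.length hγ₀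
        have h₂ := congrArg List.length hδ
        simp only [length_srcList, List.length_cons] at h₁ h₂
        simp only [length_append] at hlen
        omega
      have hlenαδ : (α.append δ).length ≤ n := by
        have h₁ := congrArg List.length hγ₀
        simp only [length_srcList, List.length_cons] at h₁
        simp only [length_append] at hlen ⊢
        omega
      -- darts
      have hDγ₀ : γ₀.Darts ⊆ w.Darts := fun x hx ↦ hD (by simp only [darts_append]; exact Or.inr (Or.inl hx))
      have hDαδ : (α.append δ).Darts ⊆ w.Darts := fun x hx ↦ hD (by
        simp only [darts_append, mem_union] at hx ⊢
        rcases hx with hx | hx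
        · exact Or.inl hx
        · exact Or.inr (Or.inr hx))
      -- erase `γ₀`
      have hγ₀ : γ₀.comp.Homotopic (Path.refl _) := ih b'' γ₀ hlenγ₀ hDγ₀
      have hαδ : (α.append δ).comp.Homotopic (Path.refl _) := ih b (α.append δ) hlenαδ hDαδ
      exact (comp_homotopic_erase α γ₀ δ hγ₀).trans hαδ

end Walk

end Literature.Topology.PlanarFoliations
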